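import Literature.Computability.Complexity.EquivalenceProblems
import Literature.Computability.QuantumComplexity.SimonBQP
import Literature.Computability.Complexity.BinarySubtraction
import Literature.Computability.Complexity.LengthCompare
import HarnessLib

/-!
# Fortnow–Grochow 2011, Thm. 4.3 (i): `Ker = PEq ⟹ UP ⊆ BQP` — the discharge

Proof companion of `EquivalenceProblems.lean`: the named fact
`Literature.Computability.Complexity.fortnowGrochow_Ker_eq_PEq_UP_subset_BQP` ("If `Ker = PEq` then
`UP ⊆ BQP`", L. Fortnow, J. A. Grochow, *Complexity classes of equivalence problems revisited*,
arXiv:0907.4775, Thm. 4.3, first half) is proved: **`fortnowGrochow_Ker_eq_PEq_UP_subset_BQP_holds`**.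
The printed proof is followed: for `L ∈ UP` (verifier `L' ∈ P`, witness bound `p`) the relation
`R_L = {((a,x),(a,y)) : x = y or |x| = |y| and V(a, x ⊕ y) = 1}` is an equivalence relation with
recognition problem in `P`, so `Ker = PEq` gives a complete invariant `f ∈ FP`; `f_a = f(a, ·)` is then
injective if `a ∉ L` and invariant under the xor-mask `w_a` (the witness) if `a ∈ L`, and deciding which
is Simon's problem, in `BQP`. Here:

* the witnesses are PADDED to the fixed nonzero form `y 1 0^{p(|a|)−|y|}` of length `Q = p + 1`
  (`KerPEq.IsPadWit`, via `SimonSampler.codeR`): the printed `R_L` makes `f_a` injective — the wrong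
  side — when `a`'s witness is `0^ℓ`, a case the printed proof overlooks (it is handled in the
  paper's RP half); with padding the mask is never zero;
* `KerPEq.rel` is `R_L` on padded witnesses; **`rel_equivalence`** (transitivity is the unambiguity
  of `UP`) and **`relLang_rel_mem_P`** — an explicit polynomial-time decider `dDEC` in the brick
  algebra (re-pairing tests, lengths in unary, `xorStrFn`, nonzero test, unpadding `unpadV` through
  the canonical numeral of the value of a word, the indicator of `L' ∈ P`), with its value `dDEC_apply`
  and correctness `dDEC_eq_true_iff`;
* the assembly: `R_L ∈ PEq`, the complete invariant `f ∈ FP` from the hypothesis, its output-length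
  polynomial, the nonzero mask on `a ∈ L` and injectivity on `a ∉ L`, and Simon's theorem for white-box
  functions `QuantumComplexity.SimonSampler.mem_BQP_of_simonPromise` (`SimonBQP.lean`, with
  `SimonSamplerBricks/Spec/Law.lean`, `SimonPostFP.lean`, `PhaseQueryKernel.lean`,
  `SimonBlockFourier.lean`, `GF2KernelProgram.lean`).

## References

* L. Fortnow, J. A. Grochow, *Complexity classes of equivalence problems revisited*, Inform. and
  Comput. 209 (2011) 748–763 = arXiv:0907.4775, Thm. 4.3 and its proof [FortnowGrochow2011].
* D. R. Simon, *On the power of quantum computation*, SIAM J. Comput. 26 (1997), §3.1 [Simon1997].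
* L. Valiant, *Relative complexity of checking and evaluating*, Inform. Process. Lett. 5 (1976) (`UP`)
  [Valiant1976].
* S. Arora, B. Barak, *Computational Complexity: A Modern Approach*, CUP 2009, §1.3 [AroraBarak2009].
-/

noncomputable section

namespace Literature.Computability.Complexity

open _root_.Computability Polynomial Brick Plumb QuantumComplexity QuantumComplexity.SimonSampler

namespace KerPEq

/-! ### Xor of bit lists -/

/-- Bitwise xor of two bit lists (truncating). [folklore] -/
def xorL (y y' : List Bool) : List Bool := List.zipWith xor y y'

/-- Length of a xor. [folklore] -/
@[simp] theorem length_xorL (y y' : List Bool) : (xorL y y').length = min y.length y'.length := by simp [xorL]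

/-- Xor is commutative. [folklore] -/
theorem xorL_comm : ∀ y y' : List Bool, xorL y y' = xorL y' y
  | [], [] => rfl
  | [], _ :: _ => rfl
  | _ :: _, [] => rfl
  | a :: y, b :: y' => by rw [xorL, xorL, List.zipWith_cons_cons, List.zipWith_cons_cons, Bool.xor_comm]; exact congrArg _ (xorL_comm y y')

/-- Xor cancels: `y = (y ⊕ y') ⊕ y'` for equal lengths. [folklore] -/
theorem eq_xorL_xorL : ∀ y y' : List Bool, y.length = y'.length → y = xorL (xorL y y') y'
  | [], [], _ => rfl
  | a :: y, b :: y', h => by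
    rw [xorL, xorL, List.zipWith_cons_cons, List.zipWith_cons_cons, Bool.xor_assoc, Bool.xor_self, Bool.xor_false]
    exact congrArg _ (eq_xorL_xorL y y' (by simpa using h))
  | [], _ :: _, h => by simp at h
  | _ :: _, [], h => by simp at h

/-- Xor of vectors. [folklore] -/
theorem xorL_ofFn {n : ℕ} (y s : Fin n → Bool) : xorL (List.ofFn y) (List.ofFn s) = List.ofFn fun i => xor (y i) (s i) := by
  apply List.ext_getElem (by simp)
  intro i h₁ h₂
  simp [xorL]

/-! ### Padded witnesses and the Fortnow–Grochow relation -/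

section Rel

variable (L' : Language Bool) (p : Polynomial ℕ)

/-- The padded witness length `Q(n) = p(n) + 1`. [cite: FortnowGrochow2011, Thm. 4.3 (proof)] -/
abbrev Qv (n : ℕ) : ℕ := (p + 1).eval n

/-- `Q(n) = p(n) + 1`. [folklore] -/
theorem Qv_eq (n : ℕ) : Qv p n = p.eval n + 1 := by simp [Qv]

/-- **Padded witnesses**: `w = y 1 0^{p(|a|) - |y|}` (`= codeR Q y`) for a witness `y` of `a`
(`|y| ≤ p(|a|)`, `⟨a, y⟩ ∈ L'`). Padding makes the witness length exactly `Q(|a|)` and the padded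
witness nonzero (the printed proof overlooks the witness `0^ℓ`, for which `f_a` is injective although
`a ∈ L`). [cite: FortnowGrochow2011, Thm. 4.3 (proof)] -/
def IsPadWit (a w : List Bool) : Prop := ∃ y, y.length ≤ p.eval a.length ∧ w = codeR (Qv p a.length) y ∧ boolPair a y ∈ L'

/-- **The relation `R_L` of Fortnow–Grochow** (on padded witnesses): `(a, x) ~ (a, y)` iff `x = y` or
`|x| = |y| = Q(|a|)` and `x ⊕ y` is the padded witness of `a`; every other string is related only to
itself. [cite: FortnowGrochow2011, Thm. 4.3 (proof: `R_L`)] -/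
def rel (u v : List Bool) : Prop :=
  u = v ∨ ∃ a y y', u = boolPair a y ∧ v = boolPair a y' ∧ y.length = Qv p a.length ∧ y'.length = Qv p a.length ∧
    IsPadWit L' p a (xorL y y')

variable {L' p}

/-- **Unambiguity**: two padded witnesses of `a` coincide. [cite: Valiant1976] -/
theorem IsPadWit.unique (hsub : ∀ x : List Bool, {y : List Bool | y.length ≤ p.eval x.length ∧ boolPair x y ∈ L'}.Subsingleton)
    {a w w' : List Bool} (hw : IsPadWit L' p a w) (hw' : IsPadWit L' p a w') : w = w' := by
  obtain ⟨y, hy, rfl, hyL⟩ := hw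
  obtain ⟨y', hy', rfl, hyL'⟩ := hw'
  rw [hsub a ⟨hy, hyL⟩ ⟨hy', hyL'⟩]

/-- `boolPair` is injective in both arguments. [folklore] -/
theorem boolPair_inj {a y a' y' : List Bool} (h : boolPair a y = boolPair a' y') : a = a' ∧ y = y' := by
  have := congrArg boolUnpair h
  rw [boolUnpair_boolPair, boolUnpair_boolPair, Prod.mk.injEq] at this
  exact this

/-- **`R_L` is an equivalence relation** (given unambiguity). [cite: FortnowGrochow2011, Thm. 4.3 (proof: "Clearly `R_L ∈ PEq`")] -/
theorem rel_equivalence (hsub : ∀ x : List Bool, {y : List Bool | y.length ≤ p.eval x.length ∧ boolPair x y ∈ L'}.Subsingleton) :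
    Equivalence (rel L' p) where
  refl u := Or.inl rfl
  symm := by
    rintro u v (rfl | ⟨a, y, y', rfl, rfl, hy, hy', hw⟩)
    · exact Or.inl rfl
    · exact Or.inr ⟨a, y', y, rfl, rfl, hy', hy, by rwa [xorL_comm]⟩
  trans := by
    rintro u v w (rfl | ⟨a, y, y', rfl, rfl, hy, hy', hw⟩) h2
    · exact h2
    · rcases h2 with rfl | ⟨a₂, z, z', hv, rfl, hz, hz', hw₂⟩
      · exact Or.inr ⟨a, y, y', rfl, rfl, hy, hy', hw⟩
      · obtain ⟨rfl, rfl⟩ := boolPair_inj hv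
        have e := IsPadWit.unique hsub hw hw₂
        have : y = z' := by
          rw [eq_xorL_xorL y y' (by rw [hy, hy']), e, xorL_comm y' z', ← eq_xorL_xorL z' y' (by rw [hz', hy'])]
        subst this
        exact Or.inl rfl

end Rel

/-! ### The recognition problem of `R_L` is in `P`: the decider -/

section Decider

/-- The piece of the xor fold on `⟨⟨a, b⟩, 1ᵖ⟩`: `[a_p ⊕ b_p]`. [folklore] -/
def xorPiece : List Bool → List Bool :=
  HashBricks.xorFn (HashBricks.headBitFn ∘ bitAtFn ∘ fanoutFn sndF (fstF ∘ fstF))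
    (HashBricks.headBitFn ∘ bitAtFn ∘ fanoutFn sndF (sndF ∘ fstF))

/-- `xorPiece ∈ FP`. [folklore] -/
theorem xorPiece_mem_FP : xorPiece ∈ FP :=
  HashBricks.xorFn_mem_FP
    (comp_mem_FP HashBricks.headBitFn_mem_FP (comp_mem_FP bitAtFn_mem_FP
      (fanoutFn_mem_FP sndF_mem_FP (comp_mem_FP fstF_mem_FP fstF_mem_FP))))
    (comp_mem_FP HashBricks.headBitFn_mem_FP (comp_mem_FP bitAtFn_mem_FP
      (fanoutFn_mem_FP sndF_mem_FP (comp_mem_FP sndF_mem_FP fstF_mem_FP))))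

/-- Value of `xorPiece`. [folklore] -/
theorem xorPiece_apply (w : List Bool) (q : ℕ) :
    xorPiece (boolPair w (ones q)) = [xor (((fstF w).drop q).headD false) (((sndF w).drop q).headD false)] := by
  rw [xorPiece, HashBricks.xorFn_apply (b := ((fstF w).drop q).headD false) (b' := ((sndF w).drop q).headD false)]
  · simp only [Function.comp_apply, fanoutFn_apply, sndF_boolPair, fstF_boolPair, bitAtFn_boolPair,
      HashBricks.headBitFn_apply, List.length_replicate, ones]
    cases (fstF w).drop q <;> simp
  · simp only [Function.comp_apply, fanoutFn_apply, sndF_boolPair, fstF_boolPair, bitAtFn_boolPair,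
      HashBricks.headBitFn_apply, List.length_replicate, ones]
    cases (sndF w).drop q <;> simp

/-- `xorPiece` is one-bit. [folklore] -/
theorem oneBit_xorPiece : OneBit xorPiece :=
  HashBricks.oneBit_xorFn (HashBricks.oneBit_headBitFn.comp _) (HashBricks.oneBit_headBitFn.comp _)

/-- **Bitwise xor** `⟨a, b⟩ ↦ (a_q ⊕ b_q)_{q < |a|}` (as `Learning/GLStageFP.xorStrFn`, re-proved to keep
the import light). [folklore] -/
def xorStrFn : List Bool → List Bool :=
  sndPow 2 ∘ foldLoop appF (clipF 1 xorPiece) X ∘ fanoutFn id (fanoutFn (lenBinF ∘ fstF) (fun _ => boolPair [] []))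

/-- `xorStrFn ∈ FP`. [folklore] -/
theorem xorStrFn_mem_FP : xorStrFn ∈ FP :=
  comp_mem_FP (sndPow_mem_FP 2) (comp_mem_FP (foldLoop_clipF_mem_FP 1 appF_mem_FP length_appF_le xorPiece_mem_FP X)
    (fanoutFn_mem_FP (PolyTimeComputable.id _) (fanoutFn_mem_FP (comp_mem_FP lenBinF_mem_FP fstF_mem_FP) (const_mem_FP _))))

/-- Value of `xorStrFn` on every input. [folklore] -/
theorem xorStrFn_apply (w : List Bool) :
    xorStrFn w = ccat (fun q => [xor (((fstF w).drop q).headD false) (((sndF w).drop q).headD false)]) (fstF w).length := by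
  have hn : (fstF w).length ≤ X.eval w.length := by
    rw [eval_X]; have := length_fstF_sndF_le w; omega
  rw [xorStrFn, Function.comp_apply, Function.comp_apply, fanoutFn_apply, fanoutFn_apply, id, Function.comp_apply, lenBinF_apply,
    show (boolPair ([] : List Bool) []) = boolPair (ones 0) ([] : List Bool) by rfl,
    foldLoop_apply _ _ hn, foldAcc_clipF (fun j _ _ => by rw [(oneBit_xorPiece).length_eq]; omega), foldAcc_appF]
  simp [sndPow, xorPiece_apply]

/-- Reading position `i < |l|` through `drop`/`headD`. [folklore] -/
theorem headD_drop_eq_getElem (l : List Bool) {i : ℕ} (hi : i < l.length) : (l.drop i).headD false = l[i] := by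
  rw [List.drop_eq_getElem_cons hi]; rfl

/-- **Value of `xorStrFn` on strings of equal length**: the xor. [folklore] -/
theorem xorStrFn_boolPair {y y' : List Bool} (h : y.length = y'.length) : xorStrFn (boolPair y y') = xorL y y' := by
  rw [xorStrFn_apply, fstF_boolPair, sndF_boolPair, ccat_singleton_eq_ofFn]
  apply List.ext_getElem
  · simp [h]
  · intro i h₁ h₂
    simp only [List.length_ofFn] at h₁
    rw [List.getElem_ofFn]
    simp only [xorL, List.getElem_zipWith]
    rw [headD_drop_eq_getElem y h₁, headD_drop_eq_getElem y' (h ▸ h₁)]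

/-! #### Unpadding -/

/-- **Unpadding** a padded witness `y 1 0^k ↦ y`: the canonical numeral of the value of `w` (this strips
the final zeros, `encodeNat_bitsToNat`) without its last symbol. [folklore] -/
def unpadV (w : List Bool) : List Bool := (encodeNat (bitsToNat w)).take ((encodeNat (bitsToNat w)).length - 1)

/-- Unpadding a padded word. [folklore] -/
theorem unpadV_pad (y : List Bool) (k : ℕ) : unpadV (y ++ true :: List.replicate k false) = y := by
  rw [unpadV, show y ++ true :: List.replicate k false = (y ++ [true]) ++ List.replicate k false by simp,
    bitsToNat_append_replicate_false, encodeNat_bitsToNat (isCanonicalNum_append_true y)]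
  simp

/-- **A nonzero word is a padded word** `y 1 0^k`. [folklore] -/
theorem exists_eq_pad_of_ne_zeros {w : List Bool} (hw : w ≠ List.replicate w.length false) :
    ∃ (y : List Bool) (k : ℕ), w = y ++ true :: List.replicate k false := by
  obtain ⟨j, hj⟩ := stripMSB_append_replicate w
  have hne : stripMSB w ≠ [] := fun h => by
    rw [h, List.nil_append] at hj
    have : j = w.length := by rw [hj]; simp
    exact hw (this ▸ hj)
  rcases isCanonicalNum_stripMSB w with h0 | hlast
  · exact absurd h0 hne
  · obtain ⟨y, b, hyb⟩ := List.eq_nil_or_concat (stripMSB w) |>.resolve_left hne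
    rw [List.concat_eq_append] at hyb
    rw [hyb, List.getLast?_concat] at hlast
    obtain rfl : b = true := Option.some_inj.1 hlast
    exact ⟨y, j, by rw [hj, hyb]; simp⟩

/-- The padding is unique: the position of the last `1` determines the word. [folklore] -/
theorem pad_inj {y y' : List Bool} {k k' : ℕ} (h : y ++ true :: List.replicate k false = y' ++ true :: List.replicate k' false) : y = y' := by
  have h' := congrArg (fun l : List Bool => (l.reverse.dropWhile fun b => b == false).tail.reverse) h
  simp only [List.reverse_append, List.reverse_cons, List.reverse_replicate, List.append_assoc, List.singleton_append,
    dropWhile_replicate_false_append, List.tail_cons, List.reverse_reverse] at h'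
  exact h'

/-! #### The string functions of the decider -/

variable (L' : Language Bool) (p : Polynomial ℕ)

/-- `a` of `t = ⟨⟨a, y⟩, ⟨a', y'⟩⟩`. [folklore] -/
def dA : List Bool → List Bool := fstF ∘ fstF
/-- `y`. [folklore] -/
def dY : List Bool → List Bool := sndF ∘ fstF
/-- `a'`. [folklore] -/
def dA' : List Bool → List Bool := fstF ∘ sndF
/-- `y'`. [folklore] -/
def dY' : List Bool → List Bool := sndF ∘ sndF
/-- `t` is a genuine pair `⟨u, v⟩`. [folklore] -/
def dGEN : List Bool → List Bool := eqPairFn ∘ fanoutFn (fanoutFn fstF sndF) id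
/-- `u = v`. [folklore] -/
def dEQ : List Bool → List Bool := eqPairFn ∘ fanoutFn fstF sndF
/-- `u` is a genuine pair. [folklore] -/
def dGENU : List Bool → List Bool := eqPairFn ∘ fanoutFn (fanoutFn dA dY) fstF
/-- `v` is a genuine pair. [folklore] -/
def dGENV : List Bool → List Bool := eqPairFn ∘ fanoutFn (fanoutFn dA' dY') sndF
/-- `a = a'`. [folklore] -/
def dEQA : List Bool → List Bool := eqPairFn ∘ fanoutFn dA dA'
/-- `1^{Q(|a|)}`. [folklore] -/
def dQ : List Bool → List Bool := polyFn (p + 1) ∘ dA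
/-- `|y| = Q(|a|)`. [folklore] -/
def dLY : List Bool → List Bool := eqPairFn ∘ fanoutFn (Kannan.zerosFn ∘ dY) (Kannan.zerosFn ∘ dQ p)
/-- `|y'| = Q(|a|)`. [folklore] -/
def dLY' : List Bool → List Bool := eqPairFn ∘ fanoutFn (Kannan.zerosFn ∘ dY') (Kannan.zerosFn ∘ dQ p)
/-- `w = y ⊕ y'`. [folklore] -/
def dW : List Bool → List Bool := xorStrFn ∘ fanoutFn dY dY'
/-- `w ≠ 0^{|w|}`. [folklore] -/
def dNZ : List Bool → List Bool := notFn (eqPairFn ∘ fanoutFn dW (Kannan.zerosFn ∘ dW))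
/-- The canonical numeral of the value of a word. [folklore] -/
def dCANON : List Bool → List Bool := addFn ∘ fanoutFn id (fun _ => [])
/-- A word without its last symbol. [folklore] -/
def dDROPLAST : List Bool → List Bool := takeFn ∘ fanoutFn List.tail id
/-- `unpadV w`. [folklore] -/
def dUNPAD : List Bool → List Bool := dDROPLAST ∘ dCANON ∘ dW
/-- `[⟨a, unpadV w⟩ ∈ L']`. [folklore] -/
def dIND : List Bool → List Bool := (fun x => encodeBool (L'.boolIndicator x)) ∘ fanoutFn dA dUNPAD
/-- The conjunction of the second clause of `R_L`. [folklore] -/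
def dCONJ : List Bool → List Bool := andFn dGENU (andFn dGENV (andFn dEQA (andFn (dLY p) (andFn (dLY' p) (andFn dNZ (dIND L'))))))
/-- **The decider of the recognition problem of `R_L`.** [cite: FortnowGrochow2011, Thm. 4.3 (proof: "Clearly `R_L ∈ PEq`")] -/
def dDEC : List Bool → List Bool := andFn dGEN (iteFn dEQ (fun _ => [true]) (dCONJ L' p))

/-- The value of the second clause of the decider, as a Boolean. [folklore] -/
def conjV (t : List Bool) : Bool :=
  decide (boolPair (fstF (fstF t)) (sndF (fstF t)) = fstF t) && (decide (boolPair (fstF (sndF t)) (sndF (sndF t)) = sndF t) &&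
    (decide (fstF (fstF t) = fstF (sndF t)) &&
      (decide ((sndF (fstF t)).length = Qv p (fstF (fstF t)).length) && (decide ((sndF (sndF t)).length = Qv p (fstF (fstF t)).length) &&
        ((!decide (dW t = List.replicate (dW t).length false)) && L'.boolIndicator (boolPair (fstF (fstF t)) (unpadV (dW t))))))))

/-- The value of the decider, as a Boolean. [folklore] -/
def decV (t : List Bool) : Bool := decide (boolPair (fstF t) (sndF t) = t) && (decide (fstF t = sndF t) || conjV L' p t)

variable {L' p}

/-- Values of `dCANON`, `dDROPLAST`, `dUNPAD`. [folklore] -/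
theorem dUNPAD_apply (t : List Bool) : dUNPAD t = unpadV (dW t) := by
  simp [dUNPAD, dDROPLAST, dCANON, unpadV, fanoutFn_apply]

/-- **The string functions are polynomial time** (`L' ∈ P`). [cite: AroraBarak2009, §1.3] -/
theorem dDEC_mem_FP (hL' : L' ∈ Classes.P) : dDEC L' p ∈ FP := by
  have hA : dA ∈ FP := comp_mem_FP fstF_mem_FP fstF_mem_FP
  have hY : dY ∈ FP := comp_mem_FP sndF_mem_FP fstF_mem_FP
  have hA' : dA' ∈ FP := comp_mem_FP fstF_mem_FP sndF_mem_FP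
  have hY' : dY' ∈ FP := comp_mem_FP sndF_mem_FP sndF_mem_FP
  have hGEN : dGEN ∈ FP := comp_mem_FP eqPairFn_mem_FP (fanoutFn_mem_FP (fanoutFn_mem_FP fstF_mem_FP sndF_mem_FP) (PolyTimeComputable.id _))
  have hEQ : dEQ ∈ FP := comp_mem_FP eqPairFn_mem_FP (fanoutFn_mem_FP fstF_mem_FP sndF_mem_FP)
  have hGENU : dGENU ∈ FP := comp_mem_FP eqPairFn_mem_FP (fanoutFn_mem_FP (fanoutFn_mem_FP hA hY) fstF_mem_FP)
  have hGENV : dGENV ∈ FP := comp_mem_FP eqPairFn_mem_FP (fanoutFn_mem_FP (fanoutFn_mem_FP hA' hY') sndF_mem_FP)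
  have hEQA : dEQA ∈ FP := comp_mem_FP eqPairFn_mem_FP (fanoutFn_mem_FP hA hA')
  have hQ : dQ p ∈ FP := comp_mem_FP (polyFn_mem_FP _) hA
  have hLY : dLY p ∈ FP := comp_mem_FP eqPairFn_mem_FP (fanoutFn_mem_FP (comp_mem_FP Kannan.zerosFn_mem_FP hY) (comp_mem_FP Kannan.zerosFn_mem_FP hQ))
  have hLY' : dLY' p ∈ FP := comp_mem_FP eqPairFn_mem_FP (fanoutFn_mem_FP (comp_mem_FP Kannan.zerosFn_mem_FP hY') (comp_mem_FP Kannan.zerosFn_mem_FP hQ))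
  have hW : dW ∈ FP := comp_mem_FP xorStrFn_mem_FP (fanoutFn_mem_FP hY hY')
  have hNZ : dNZ ∈ FP := notFn_mem_FP (comp_mem_FP eqPairFn_mem_FP (fanoutFn_mem_FP hW (comp_mem_FP Kannan.zerosFn_mem_FP hW)))
  have hCANON : dCANON ∈ FP := comp_mem_FP addFn_mem_FP (fanoutFn_mem_FP (PolyTimeComputable.id _) (const_mem_FP _))
  have hDROP : dDROPLAST ∈ FP := comp_mem_FP takeFn_mem_FP (fanoutFn_mem_FP PRelSigma.tail_mem_FP (PolyTimeComputable.id _))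
  have hUNPAD : dUNPAD ∈ FP := comp_mem_FP hDROP (comp_mem_FP hCANON hW)
  have hIND : dIND L' ∈ FP := comp_mem_FP (indicatorFn_mem_FP hL') (fanoutFn_mem_FP hA hUNPAD)
  exact andFn_mem_FP hGEN (iteFn_mem_FP hEQ (const_mem_FP _)
    (andFn_mem_FP hGENU (andFn_mem_FP hGENV (andFn_mem_FP hEQA (andFn_mem_FP hLY (andFn_mem_FP hLY' (andFn_mem_FP hNZ hIND)))))))

/-- The decider is one-bit. [folklore] -/
theorem oneBit_dDEC : OneBit (dDEC L' p) := by
  have e : ∀ f g : List Bool → List Bool, OneBit (eqPairFn ∘ fanoutFn f g) := fun f g t => ⟨_, by rw [Function.comp_apply, fanoutFn_apply, eqPairFn_boolPair]⟩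
  refine oneBit_andFn (e _ _) (OneBit.ite (e _ _) (oneBit_const _) ?_)
  refine oneBit_andFn (e _ _) (oneBit_andFn (e _ _) (oneBit_andFn (e _ _) (oneBit_andFn (e _ _) (oneBit_andFn (e _ _)
    (oneBit_andFn (oneBit_notFn (e _ _)) fun t => ⟨_, rfl⟩)))))

/-- Reading the Boolean indicator of a language. [folklore] -/
theorem boolIndicator_eq_true_iff' (L : Language Bool) (x : List Bool) : L.boolIndicator x = true ↔ x ∈ L :=
  (Set.mem_iff_boolIndicator (L : Set (List Bool)) x).symm

/-- **The value of the decider.** [folklore] -/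
theorem dDEC_apply (t : List Bool) : dDEC L' p t = [decV L' p t] := by
  have e : ∀ (f g : List Bool → List Bool) (t : List Bool), (eqPairFn ∘ fanoutFn f g) t = [decide (f t = g t)] := fun f g t => by
    rw [Function.comp_apply, fanoutFn_apply, eqPairFn_boolPair]
  have hLY : dLY p t = [decide ((sndF (fstF t)).length = Qv p (fstF (fstF t)).length)] := by
    rw [dLY, e]; simp only [Function.comp_apply, Kannan.zerosFn_apply, dY, dQ, dA, polyFn_apply, ones, List.length_replicate]
    congr 1; apply Bool.decide_congr
    exact ⟨fun h => by simpa using congrArg List.length h, fun h => by rw [h]⟩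
  have hLY' : dLY' p t = [decide ((sndF (sndF t)).length = Qv p (fstF (fstF t)).length)] := by
    rw [dLY', e]; simp only [Function.comp_apply, Kannan.zerosFn_apply, dY', dQ, dA, polyFn_apply, ones, List.length_replicate]
    congr 1; apply Bool.decide_congr
    exact ⟨fun h => by simpa using congrArg List.length h, fun h => by rw [h]⟩
  have hNZ : dNZ t = [!decide (dW t = List.replicate (dW t).length false)] := by
    rw [dNZ, notFn_apply (e _ _ t)]; simp only [Function.comp_apply, Kannan.zerosFn_apply]
  have hIND : dIND L' t = [L'.boolIndicator (boolPair (fstF (fstF t)) (unpadV (dW t)))] := by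
    rw [dIND, Function.comp_apply, fanoutFn_apply, dUNPAD_apply]; rfl
  have hGEN : dGEN t = [decide (boolPair (fstF t) (sndF t) = t)] := by rw [dGEN, e]; simp only [fanoutFn_apply, id]
  have hEQ : dEQ t = [decide (fstF t = sndF t)] := by rw [dEQ, e]
  have hGENU : dGENU t = [decide (boolPair (fstF (fstF t)) (sndF (fstF t)) = fstF t)] := by
    rw [dGENU, e]; simp only [fanoutFn_apply, dA, dY, Function.comp_apply]
  have hGENV : dGENV t = [decide (boolPair (fstF (sndF t)) (sndF (sndF t)) = sndF t)] := by
    rw [dGENV, e]; simp only [fanoutFn_apply, dA', dY', Function.comp_apply]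
  have hEQA : dEQA t = [decide (fstF (fstF t) = fstF (sndF t))] := by rw [dEQA, e]; rfl
  have hCONJ : dCONJ L' p t = [conjV L' p t] := by
    rw [dCONJ, andFn_apply hGENU (andFn_apply hGENV (andFn_apply hEQA (andFn_apply hLY (andFn_apply hLY' (andFn_apply hNZ hIND))))), conjV]
  have hOR : iteFn dEQ (fun _ => [true]) (dCONJ L' p) t = [decide (fstF t = sndF t) || conjV L' p t] := by
    rw [iteFn_apply hEQ]
    by_cases h : fstF t = sndF t
    · simp [h]
    · rw [if_neg (by simpa using h), hCONJ]; simp [h]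
  rw [dDEC, andFn_apply hGEN hOR, decV]

/-- `dW` on a genuine instance is the xor. [folklore] -/
theorem dW_eq {t : List Bool} (h : (sndF (fstF t)).length = (sndF (sndF t)).length) : dW t = xorL (sndF (fstF t)) (sndF (sndF t)) := by
  rw [dW, Function.comp_apply, fanoutFn_apply]; exact xorStrFn_boolPair h

/-- A padded word is not zero. [folklore] -/
theorem pad_ne_zeros (y : List Bool) (k n : ℕ) : y ++ true :: List.replicate k false ≠ List.replicate n false := fun h => by
  have := congrArg (fun l : List Bool => l.getD y.length false) h
  simp at this

/-- **Correctness of the decider**: it accepts exactly the recognition problem of `R_L`.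
[cite: FortnowGrochow2011, Thm. 4.3 (proof: "Clearly `R_L ∈ PEq`")] -/
theorem dDEC_eq_true_iff (t : List Bool) : dDEC L' p t = [true] ↔ t ∈ relLang (rel L' p) := by
  rw [dDEC_apply, List.singleton_inj]
  change _ ↔ ∃ u v, t = boolPair u v ∧ rel L' p u v
  constructor
  · intro h
    simp only [decV, conjV, Bool.and_eq_true, decide_eq_true_eq, Bool.or_eq_true] at h
    obtain ⟨hgen, h⟩ := h
    refine ⟨fstF t, sndF t, hgen.symm, ?_⟩
    rcases h with huv | ⟨hgu, hgv, haa, hly, hly', hnz, hind⟩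
    · exact Or.inl huv
    · set a := fstF (fstF t); set y := sndF (fstF t); set a' := fstF (sndF t); set y' := sndF (sndF t)
      have hlen : y.length = y'.length := by rw [hly, hly']
      rw [dW_eq hlen] at hnz hind
      simp only [Bool.not_eq_true', decide_eq_false_iff_not] at hnz
      obtain ⟨y₁, k, hw⟩ := exists_eq_pad_of_ne_zeros hnz
      rw [hw, unpadV_pad] at hind
      have hQ : (xorL y y').length = Qv p a.length := by rw [length_xorL, hly, hly', Nat.min_self]
      have h1 : (xorL y y').length = y₁.length + (k + 1) := by rw [hw]; simp
      have hQv := Qv_eq p a.length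
      refine Or.inr ⟨a, y, y', hgu.symm, by rw [haa]; exact hgv.symm, hly, hly', y₁, by omega, ?_, ?_⟩
      · have hk : Qv p a.length - y₁.length - 1 = k := by omega
        rw [hw, codeR_eq (by omega), hk]
      · exact (boolIndicator_eq_true_iff' L' _).1 hind
  · rintro ⟨u, v, rfl, hr⟩
    simp only [decV, conjV, fstF_boolPair, sndF_boolPair, decide_true, Bool.true_and, Bool.or_eq_true, decide_eq_true_eq]
    rcases hr with huv | ⟨a, y, y', rfl, rfl, hy, hy', y₀, hy₀, hw, hL⟩
    · exact Or.inl huv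
    · by_cases huv : boolPair a y = boolPair a y'
      · exact Or.inl huv
      · right
        simp only [fstF_boolPair, sndF_boolPair, decide_true, Bool.true_and, hy, hy', Bool.and_eq_true, Bool.not_eq_true',
          decide_eq_false_iff_not]
        have hlen : (sndF (fstF (boolPair (boolPair a y) (boolPair a y')))).length = (sndF (sndF (boolPair (boolPair a y) (boolPair a y')))).length := by
          simp [hy, hy']
        rw [dW_eq hlen]
        simp only [fstF_boolPair, sndF_boolPair]
        have hlt : y₀.length < Qv p a.length := by rw [Qv_eq]; omega
        rw [hw, codeR_eq hlt, unpadV_pad]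
        exact ⟨pad_ne_zeros _ _ _, (boolIndicator_eq_true_iff' L' _).2 hL⟩

/-- **The recognition problem of `R_L` is in `P`.** [cite: FortnowGrochow2011, Thm. 4.3 (proof: "Clearly `R_L ∈ PEq`")] -/
theorem relLang_rel_mem_P (hL' : L' ∈ Classes.P) : relLang (rel L' p) ∈ Classes.P :=
  mem_P_of_mem_FP (dDEC_mem_FP hL') _ fun t =>
    ⟨fun h => (dDEC_eq_true_iff t).2 h, fun h => by
      obtain ⟨b, hb⟩ := oneBit_dDEC (L' := L') (p := p) t
      cases b
      · exact hb
      · exact absurd ((dDEC_eq_true_iff t).1 hb) h⟩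

end Decider

/-! ### The xor-mask structure of the complete invariant, and the theorem -/

section Assembly

/-- `ofFn` of the bits of a list of the right length is the list. [folklore] -/
theorem ofFn_getD {Q : ℕ} {l : List Bool} (hl : l.length = Q) : (List.ofFn fun i : Fin Q => l.getD i false) = l := by
  apply List.ext_getElem (by simp [hl])
  intro i h₁ h₂
  rw [List.getElem_ofFn, List.getD_eq_getElem?_getD, List.getElem?_eq_getElem h₂, Option.getD_some]

/-- Xoring the mask twice. [folklore] -/
theorem xorL_ofFn_xor {Q : ℕ} (y s : Fin Q → Bool) :
    xorL (List.ofFn fun i => xor (y i) (s i)) (List.ofFn y) = List.ofFn s := by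
  rw [xorL_ofFn]; congr 1; funext i; cases y i <;> cases s i <;> rfl

end Assembly

end KerPEq

open KerPEq in
/-- **Fortnow–Grochow 2011, Thm. 4.3 (first half): if `Ker = PEq` then `UP ⊆ BQP`.** Printed proof:
for `L ∈ UP` with verifier `V` and witness bound `p`, the relation
`R_L = {((a,x),(a,y)) : x = y or |x| = |y| and V(a, x ⊕ y) = 1}` is in `PEq`, so by hypothesis it has a
complete invariant `f ∈ FP`; then `f_a = f(a, ·)` is injective if `a ∉ L` and two-to-one with
`f_a(x) = f_a(x') ⟺ x ⊕ x' = w_a` (the unique witness) if `a ∈ L`, "and finding `w_a` or determining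
that there is no such string is exactly Daniel Simon's problem, which is in BQP". Formalisation: the
witnesses are first padded to the fixed nonzero form `y 1 0^{p(|a|)-|y|}` of length `p(|a|) + 1`
(`KerPEq.IsPadWit`; the printed `R_L` makes `f_a` injective when the witness is `0^ℓ`), `R_L ∈ PEq` is
`KerPEq.rel_equivalence` (unambiguity of `UP`) with `KerPEq.relLang_rel_mem_P` (an explicit
polynomial-time decider), and Simon's algorithm for the white-box function `y ↦ f ⟨a, y⟩` is
`QuantumComplexity.SimonSampler.mem_BQP_of_simonPromise` (a uniform Clifford+`T` phase-query family
sampling `m = Q + 2` Fourier samples, Gaussian elimination over `GF(2)` as classical post-processing,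
`SimonBQP.lean`). [cite: FortnowGrochow2011, Thm. 4.3] [cite: Simon1997, §3.1] -/
theorem fortnowGrochow_Ker_eq_PEq_UP_subset_BQP_holds : fortnowGrochow_Ker_eq_PEq_UP_subset_BQP := by
  intro hKer L hL
  obtain ⟨L', hL'P, p, hwit, hsub⟩ := hL
  -- `R_L ∈ PEq`, hence a complete invariant `f ∈ FP`
  have hPEq : rel L' p ∈ PEq := ⟨rel_equivalence hsub, relLang_rel_mem_P hL'P⟩
  obtain ⟨f, hf, hinv⟩ := hKer _ hPEq
  obtain ⟨B, hB⟩ := exists_poly_length_le_of_mem_FP hf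
  refine SimonSampler.mem_BQP_of_simonPromise (p + 1) (B.comp (2 * X + 2 + (p + 1)) + 1) L hf
    (fun a _ y => ?_) (fun a ha => ?_) (fun a ha y y' hfy => ?_)
  · -- the values of `f` on `⟨a, y⟩` are shorter than `B(2|a| + 2 + Q(|a|)) + 1`
    have hR : (B.comp (2 * X + 2 + (p + 1)) + 1).eval a.length = B.eval (boolPair a (List.ofFn y)).length + 1 := by
      simp [length_boolPair, eval_comp]
    rw [hR]
    exact Nat.lt_succ_of_le (hB _)
  · -- `a ∈ L`: the padded witness is a nonzero xor-mask of `y ↦ f ⟨a, y⟩`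
    obtain ⟨y₀, hy₀, hmem⟩ := (hwit a).1 ha
    have hlt : y₀.length < (p + 1).eval a.length := by simp; omega
    refine ⟨fun i => (codeR ((p + 1).eval a.length) y₀).getD i false, fun h0 => ?_, fun y => ?_⟩
    · have := congrFun h0 ⟨y₀.length, hlt⟩
      rw [codeR_eq hlt] at this
      simp at this
    · refine (hinv _ _).1 (Or.inr ⟨a, _, _, rfl, rfl, by simp, by simp, y₀, hy₀, ?_, hmem⟩)
      rw [xorL_ofFn_xor, ofFn_getD (length_codeR _ _)]
  · -- `a ∉ L`: `y ↦ f ⟨a, y⟩` is injective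
    rcases (hinv _ _).2 hfy with h | ⟨a₁, y₁, y₁', hu, -, -, -, y₀, hy₀, -, hmem⟩
    · exact List.ofFn_injective (boolPair_inj h).2
    · obtain ⟨rfl, -⟩ := boolPair_inj hu
      exact absurd ((hwit a).2 ⟨y₀, hy₀, hmem⟩) ha

end Literature.Computability.Complexity
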